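import Summits.HodgeConjecture.CorCM.MultiFieldWeilQuinticDisjoint
import HarnessLib

/-!
# MULTI-FIELD WEIL ENGINE — THE QUINTIC STEP: a quintic extension and an extension of `5`-power degree admitting no embedding of the first are
# LINEARLY DISJOINT (pure algebra; the engine of the decic tower)

Cell `pub-hodgecm2` (COR-CM), seat b30 gen 32 (2026-08-24); count-neutral own lane MULTI-FIELD WEIL ENGINE (stem `MultiFieldWeil*`).  Pure field theory over a
subfield `M → ℂ` (theorems only; no definition, no named fact, no `sorry`); nothing Hodge-theoretic is asserted and `HC_CM` is NOT proved.  Sequel of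
`CorCM/MultiFieldWeilQuinticDisjoint.lean` (Q1: the quintic degree chase `finrank_adjoin_pair_eq_of_forall_not_mem`, `[M(a, b) : M] = 25` for two quintic
generators) and the input of `CorCM/MultiFieldWeilDecicTower.lean` (any number of `(2,3)`-fivefolds over decic CM fields under non-embedding).

THE STATEMENT (§2, **`natDegree_minpoly_eq_five_of_forall_root_not_mem`**).  `E ⊇ M` an intermediate field with `[E : M] = 5^m`, `b ∈ ℂ` of degree `5` over `M`
such that NO conjugate of `b` over `M` lies in `E`.  Then `b` has degree `5` over `E`: the minimal polynomial of `b` stays irreducible over `E`, i.e. `M(b)` and `E`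
are linearly disjoint over `M`.  (For `[E : M] = 5` this is Q1; the point is that ANY `5`-power degree works, which is what an induction over a tower of quintic
extensions needs.  Without the `5`-power hypothesis the statement fails — `E` of degree `10` may contain the quadratic class field below.)

THE PROOF (no group theory).  If not, by Q1 §1 the classes of the five conjugates of `b` over `E` have sizes `{2, 3}` and two distinct conjugates `y₀ ≠ y₁`
form the class of size `2` (**`exists_quadratic_class_of_natDegree_ne_five`**).  By Vieta (§1 **`add_mem_and_mul_mem_of_minpoly_eq_of_natDegree_eq_two`**)
`u = y₀ + y₁`, `v = y₀ y₁ ∈ E`, so `F = M(u, v) ⊆ E` has degree `t ∣ 5^m` over `M`; `y₀ ∉ F` (no conjugate in `E`), so `[F(y₀) : F] = 2`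
(§1 **`natDegree_minpoly_le_two_of_add_mem_of_mul_mem`**), and `F(y₀) = M(y₀, y₁)` has degree `5 d` over `M` with `d = [M(y₀)(y₁) : M(y₀)] ≤ 4`
(**`natDegree_minpoly_adjoin_conj_le_four`**: a full class over `M(y₀)` would contain `y₀`, of degree `1`).  Hence `2 t = 5 d`, forcing `t = 5`: `F = M(a)` is a
QUINTIC extension of `M` inside `E` with `[M(a)(y₀) : M(a)] ≤ 2`, contradicting Q1 (`[M(a, y₀) : M] = 25`, whose hypothesis holds because a conjugate of `y₀` inside
some `M(x)`, `x` conjugate to `a`, transports to a conjugate inside `M(a) ⊆ E`) — **`false_of_quadratic_class`**.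

[cite: Lang2002, V §1 Prop. 1.2, VI §1 Thm. 1.1 and V §2 Thm. 2.8]

## References
* [Lang2002] S. Lang, *Algebra*, 3rd ed., GTM 211: V §1 Prop. 1.2 (tower law), V §2 Thm. 2.8 (extension of embeddings), VI §1 Thm. 1.1 (conjugates, separable
  irreducible polynomials).
-/

noncomputable section

open IntermediateField Polynomial
open scoped Classical

namespace Summit.HodgeConjecture.CorCM.MultiFieldWeil

/-! ## §1 Quadratic classes: Vieta, and a degree bound -/

section Quadratic

variable {M : Type*} [Field M] [Algebra M ℂ]

/-- **Vieta for a quadratic class.**  Two DISTINCT complex numbers with the same minimal polynomial of degree `2` over `E` have sum and product in `E`. [folklore] -/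
theorem add_mem_and_mul_mem_of_minpoly_eq_of_natDegree_eq_two (E : IntermediateField M ℂ) {y₀ y₁ : ℂ} (hy₀ : IsIntegral E y₀)
    (hmin : minpoly E y₁ = minpoly E y₀) (h2 : (minpoly E y₀).natDegree = 2) (hne : y₁ ≠ y₀) : y₀ + y₁ ∈ E ∧ y₀ * y₁ ∈ E := by
  set q := minpoly E y₀ with hq
  have hev : ∀ y : ℂ, aeval y q = algebraMap E ℂ (q.coeff 0) + algebraMap E ℂ (q.coeff 1) * y + y ^ 2 := by
    intro y
    rw [aeval_eq_sum_range, h2]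
    simp only [Finset.sum_range_succ, Finset.sum_range_zero, zero_add, pow_zero, pow_one, Algebra.smul_def, mul_one]
    have hlead : q.coeff 2 = 1 := by
      have := (minpoly.monic hy₀).coeff_natDegree
      rwa [h2] at this
    rw [hlead, map_one, one_mul]
  have h0 : aeval y₀ q = 0 := minpoly.aeval E y₀
  have h1 : aeval y₁ q = 0 := by rw [← hmin]; exact minpoly.aeval E y₁
  rw [hev] at h0 h1
  have hprod : (y₁ - y₀) * (y₁ + y₀ + algebraMap E ℂ (q.coeff 1)) = 0 := by
    have := sub_eq_zero.2 (h1.trans h0.symm)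
    rw [← this]
    ring
  have hsum : y₀ + y₁ = -algebraMap E ℂ (q.coeff 1) := by
    rcases mul_eq_zero.1 hprod with h | h
    · exact absurd (sub_eq_zero.1 h) hne
    · rw [eq_neg_iff_add_eq_zero, ← h]
      ring
  have hmul : y₀ * y₁ = algebraMap E ℂ (q.coeff 0) := by
    have hy₁ : y₁ = -algebraMap E ℂ (q.coeff 1) - y₀ := by rw [← hsum]; ring
    rw [hy₁]
    have h0' : y₀ ^ 2 = -(algebraMap E ℂ (q.coeff 0) + algebraMap E ℂ (q.coeff 1) * y₀) := by
      rw [eq_neg_iff_add_eq_zero, ← h0]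
      ring
    linear_combination (-1 : ℂ) * h0'
  refine ⟨?_, ?_⟩
  · rw [hsum]
    exact neg_mem (SetLike.coe_mem (q.coeff 1))
  · rw [hmul]
    exact SetLike.coe_mem (q.coeff 0)

/-- **A root of a quadratic with coefficients in `E` has degree `≤ 2` over `E`.**  If `y₀ + y₁ ∈ E` and `y₀ y₁ ∈ E` then `y₀` is a root of
`X² − (y₀+y₁) X + y₀y₁ ∈ E[X]`. [folklore] -/
theorem natDegree_minpoly_le_two_of_add_mem_of_mul_mem (E : IntermediateField M ℂ) {y₀ y₁ : ℂ} (hu : y₀ + y₁ ∈ E) (hv : y₀ * y₁ ∈ E) :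
    (minpoly E y₀).natDegree ≤ 2 := by
  set p : (E : Type _)[X] := C (1 : E) * X ^ 2 + C (-(⟨y₀ + y₁, hu⟩ : E)) * X + C (⟨y₀ * y₁, hv⟩ : E) with hp
  have hmonic : p.Monic := by
    rw [Monic, hp, leadingCoeff_quadratic (one_ne_zero)]
  have hroot : aeval y₀ p = 0 := by
    rw [hp]
    simp only [map_add, map_mul, aeval_C, aeval_X, map_pow, map_one, map_neg, one_mul]
    change y₀ ^ 2 + -(y₀ + y₁) * y₀ + y₀ * y₁ = 0
    ring
  have hle := Polynomial.natDegree_le_natDegree (minpoly.min E y₀ hmonic hroot)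
  exact hle.trans (by rw [hp]; exact natDegree_quadratic_le)

/-- An element of `E` has minimal polynomial of degree `1` over `E`. [folklore] -/
theorem natDegree_minpoly_eq_one_of_mem (E : IntermediateField M ℂ) {y : ℂ} (hy : y ∈ E) : (minpoly E y).natDegree = 1 :=
  minpoly.natDegree_eq_one_iff.2 ⟨⟨y, hy⟩, rfl⟩

end Quadratic

/-! ## §2 The chase over a base of `5`-power degree (abstract form) -/

section Chase

variable {M : Type*} [Field M] [Algebra M ℂ]

/-- **The quadratic class.**  `b` of degree `5` over `M`, `E ⊇ M` an intermediate field over which no conjugate of `b` has degree `1`; if the minimal polynomial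
of `b` does NOT stay irreducible over `E`, then two distinct conjugates `y₀ ≠ y₁` of `b` form a class over `E`: same minimal polynomial over `E`, of degree `2`.
(`CorCM/MultiFieldWeilQuinticDisjoint.lean` §1: the classes have sizes in `{2, 3}`, and exactly two conjugates have degree `2`.) [cite: Lang2002, VI §1 Thm. 1.1] -/
theorem exists_quadratic_class_of_natDegree_ne_five (E : IntermediateField M ℂ) {b : ℂ} (hb : IsIntegral M b) (h5b : (minpoly M b).natDegree = 5)
    (h1 : ∀ y : ℂ, aeval y (minpoly M b) = 0 → (minpoly E y).natDegree ≠ 1) (h5 : (minpoly E b).natDegree ≠ 5) :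
    ∃ y₀ y₁ : ℂ, aeval y₀ (minpoly M b) = 0 ∧ aeval y₁ (minpoly M b) = 0 ∧ y₀ ≠ y₁ ∧ minpoly E y₁ = minpoly E y₀ ∧
      (minpoly E y₀).natDegree = 2 := by
  haveI : CharZero M := (algebraMap M ℂ).charZero
  set g := minpoly M b with hgdef
  have hg0 : g ≠ 0 := minpoly.ne_zero hb
  set Y := (g.aroots ℂ).toFinset with hYdef
  have hYcard : Y.card = 5 := by rw [hYdef, card_aroots_toFinset_eq_natDegree (PerfectField.separable_of_irreducible (minpoly.irreducible hb)), h5b]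
  have hbY : b ∈ Y := (mem_aroots_toFinset_iff hg0).2 (minpoly.aeval M b)
  have hYint : ∀ y ∈ Y, IsIntegral M y := fun y hy => isAlgebraic_iff_isIntegral.mp ⟨g, hg0, (mem_aroots_toFinset_iff hg0).1 hy⟩
  have h1' : ∀ y ∈ Y, (minpoly E y).natDegree ≠ 1 := fun y hy => h1 y ((mem_aroots_toFinset_iff hg0).1 hy)
  -- every class has size `2` or `3`
  have h23 : ∀ y ∈ Y, (minpoly E y).natDegree = 2 ∨ (minpoly E y).natDegree = 3 := by
    intro y hy
    have h4 : (minpoly E y).natDegree ≠ Y.card - 1 := natDegree_minpoly_ne_card_sub_one E hg0 (by rw [hYcard]; norm_num) h1' hy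
    have hle : (minpoly E y).natDegree ≤ Y.card := natDegree_minpoly_le_card E hg0 hy
    have hpos : 0 < (minpoly E y).natDegree := minpoly.natDegree_pos (hYint y hy).tower_top
    have hne5 : (minpoly E y).natDegree ≠ 5 := fun h => h5 (by
      have := natDegree_minpoly_eq_card_of_one E hg0 hy (by rw [h, hYcard]) hbY
      rwa [hYcard] at this)
    have hne1 := h1' y hy
    rw [hYcard] at h4 hle
    omega
  -- exactly two conjugates of degree `2`; they form one class
  have hrow : (Y.filter fun y => (minpoly E y).natDegree = 2).card = 2 := card_filter_natDegree_eq_two E hg0 hYcard h23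
  obtain ⟨y₀, y₁, hne, hpair⟩ := Finset.card_eq_two.1 hrow
  have hy₀ : y₀ ∈ Y.filter fun y => (minpoly E y).natDegree = 2 := by rw [hpair]; exact Finset.mem_insert_self _ _
  have hy₁ : y₁ ∈ Y.filter fun y => (minpoly E y).natDegree = 2 := by rw [hpair]; exact Finset.mem_insert_of_mem (Finset.mem_singleton_self _)
  obtain ⟨hy₀Y, hd₀⟩ := Finset.mem_filter.1 hy₀
  have hy₁Y : y₁ ∈ Y := (Finset.mem_filter.1 hy₁).1
  have hC : Y.filter (fun y' => minpoly E y' = minpoly E y₀) = Y.filter (fun y => (minpoly E y).natDegree = 2) := by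
    refine Finset.eq_of_subset_of_card_le (fun z hz => ?_) (by rw [hrow, card_filter_minpoly_eq E hg0 hy₀Y, hd₀])
    obtain ⟨hzY, hzmin⟩ := Finset.mem_filter.1 hz
    exact Finset.mem_filter.2 ⟨hzY, by rw [hzmin, hd₀]⟩
  have hmin : minpoly E y₁ = minpoly E y₀ := by
    rw [← hC] at hy₁
    exact (Finset.mem_filter.1 hy₁).2
  exact ⟨y₀, y₁, (mem_aroots_toFinset_iff hg0).1 hy₀Y, (mem_aroots_toFinset_iff hg0).1 hy₁Y, hne, hmin, hd₀⟩

/-- **The relative degree of one conjugate over another is at most `4`.**  For conjugates `y₀, y₁` of `b` (degree `5` over `M`):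
`[M(y₀)(y₁) : M(y₀)] ≤ 4` — a full class over `M(y₀)` would contain `y₀` itself, of degree `1`. [cite: Lang2002, VI §1 Thm. 1.1] -/
theorem natDegree_minpoly_adjoin_conj_le_four {b y₀ y₁ : ℂ} (hb : IsIntegral M b) (h5b : (minpoly M b).natDegree = 5)
    (hy₀ : aeval y₀ (minpoly M b) = 0) (hy₁ : aeval y₁ (minpoly M b) = 0) : (minpoly M⟮y₀⟯ y₁).natDegree ≤ 4 := by
  haveI : CharZero M := (algebraMap M ℂ).charZero
  have hg0 : minpoly M b ≠ 0 := minpoly.ne_zero hb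
  have hYcard : ((minpoly M b).aroots ℂ).toFinset.card = 5 := by
    rw [card_aroots_toFinset_eq_natDegree (PerfectField.separable_of_irreducible (minpoly.irreducible hb)), h5b]
  have hy₀Y : y₀ ∈ ((minpoly M b).aroots ℂ).toFinset := (mem_aroots_toFinset_iff hg0).2 hy₀
  have hy₁Y : y₁ ∈ ((minpoly M b).aroots ℂ).toFinset := (mem_aroots_toFinset_iff hg0).2 hy₁
  have hle5 : (minpoly M⟮y₀⟯ y₁).natDegree ≤ ((minpoly M b).aroots ℂ).toFinset.card := natDegree_minpoly_le_card M⟮y₀⟯ hg0 hy₁Y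
  have hne5 : (minpoly M⟮y₀⟯ y₁).natDegree ≠ 5 := fun h => by
    have hall := natDegree_minpoly_eq_card_of_one M⟮y₀⟯ hg0 hy₁Y (by rw [h, hYcard]) hy₀Y
    rw [natDegree_minpoly_eq_one_of_mem M⟮y₀⟯ (mem_adjoin_simple_self M y₀), hYcard] at hall
    exact absurd hall (by norm_num)
  rw [hYcard] at hle5
  omega

/-- **No quadratic class over a base of `5`-power degree.**  `[E : M] = 5^m`, `b` of degree `5` over `M` with NO conjugate in `E`; then two distinct conjugates
`y₀ ≠ y₁` of `b` cannot form a class of degree `2` over `E`.  PROOF.  By Vieta `u = y₀ + y₁`, `v = y₀ y₁ ∈ E`; `F = M(u, v) ⊆ E` has `[F : M] = t ∣ 5^m`,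
`y₀ ∉ F`, `[F(y₀) : F] = 2`, `F(y₀) = M(y₀, y₁)` of degree `5 d` with `d ≤ 4` (`natDegree_minpoly_adjoin_conj_le_four`): `2t = 5d` forces `t = 5`, so
`F = M(a)` is a quintic extension inside `E` with `[M(a)(y₀) : M(a)] ≤ 2`, contradicting the quintic degree chase `finrank_adjoin_pair_eq_of_forall_not_mem`
(`[M(a, y₀) : M] = 25`; its hypothesis holds since a conjugate of `y₀` in some `M(x)` transports to a conjugate inside `M(a) ⊆ E`).
[cite: Lang2002, V §1 Prop. 1.2, VI §1 Thm. 1.1 and V §2 Thm. 2.8] -/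
theorem false_of_quadratic_class (E : IntermediateField M ℂ) {m : ℕ} (hfinE : Module.finrank M E = 5 ^ m) {b y₀ y₁ : ℂ} (hb : IsIntegral M b)
    (h5b : (minpoly M b).natDegree = 5) (hNR : ∀ y : ℂ, aeval y (minpoly M b) = 0 → y ∉ E) (hy₀ : aeval y₀ (minpoly M b) = 0)
    (hy₁ : aeval y₁ (minpoly M b) = 0) (hne : y₀ ≠ y₁) (hmin : minpoly E y₁ = minpoly E y₀) (hd₀ : (minpoly E y₀).natDegree = 2) : False := by
  haveI : FiniteDimensional M E := Module.finite_of_finrank_pos (by rw [hfinE]; exact pow_pos (by norm_num) m)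
  have hg0 : minpoly M b ≠ 0 := minpoly.ne_zero hb
  have hy₀M : IsIntegral M y₀ := isAlgebraic_iff_isIntegral.mp ⟨minpoly M b, hg0, hy₀⟩
  have hy₁M : IsIntegral M y₁ := isAlgebraic_iff_isIntegral.mp ⟨minpoly M b, hg0, hy₁⟩
  have hminy₀ : minpoly M y₀ = minpoly M b := minpoly_eq_of_aeval_minpoly_eq_zero hb hy₀
  -- Vieta: `u = y₀ + y₁`, `v = y₀ y₁ ∈ E`; the field `F = M(u, v) ≤ E`, of degree `t ∣ 5^m` over `M`
  obtain ⟨hu, hv⟩ := add_mem_and_mul_mem_of_minpoly_eq_of_natDegree_eq_two E hy₀M.tower_top hmin hd₀ hne.symm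
  obtain ⟨F, hFdef⟩ : ∃ F : IntermediateField M ℂ, F = adjoin M ({y₀ + y₁, y₀ * y₁} : Set ℂ) := ⟨_, rfl⟩
  have huF : y₀ + y₁ ∈ F := by rw [hFdef]; exact subset_adjoin M _ (Set.mem_insert _ _)
  have hvF : y₀ * y₁ ∈ F := by rw [hFdef]; exact subset_adjoin M _ (Set.mem_insert_of_mem _ (Set.mem_singleton _))
  have hFE : F ≤ E := by
    rw [hFdef]
    refine adjoin_le_iff.2 ?_
    rintro x (hx | hx)
    · rw [hx]
      exact hu
    · rw [Set.mem_singleton_iff.1 hx]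
      exact hv
  have ht : Module.finrank M F ∣ 5 ^ m := by rw [← hfinE]; exact finrank_dvd_of_le_right hFE
  -- `y₀ ∉ F`, so `[F(y₀) : F] = 2`
  have hy₀F : y₀ ∉ F := fun h => hNR y₀ hy₀ (hFE h)
  have hdegF : (minpoly F y₀).natDegree = 2 := by
    have hle := natDegree_minpoly_le_two_of_add_mem_of_mul_mem F huF hvF
    have hne1 : (minpoly F y₀).natDegree ≠ 1 := fun h => hy₀F (mem_of_natDegree_minpoly_eq_one F h)
    have hpos : 0 < (minpoly F y₀).natDegree := minpoly.natDegree_pos hy₀M.tower_top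
    omega
  -- `F(y₀) = M(y₀, y₁)`
  have hFy : (F⟮y₀⟯).restrictScalars M = M⟮y₀, y₁⟯ := by
    subst hFdef
    rw [adjoin_adjoin_left]
    refine le_antisymm (adjoin_le_iff.2 ?_) (adjoin_le_iff.2 ?_)
    · rintro x (hx | hx)
      · rcases hx with hx | hx
        · rw [hx]
          exact add_mem (subset_adjoin M _ (Set.mem_insert _ _)) (subset_adjoin M _ (Set.mem_insert_of_mem _ (Set.mem_singleton _)))
        · rw [Set.mem_singleton_iff.1 hx]
          exact mul_mem (subset_adjoin M _ (Set.mem_insert _ _)) (subset_adjoin M _ (Set.mem_insert_of_mem _ (Set.mem_singleton _)))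
      · rw [Set.mem_singleton_iff.1 hx]
        exact subset_adjoin M _ (Set.mem_insert _ _)
    · rintro x (hx | hx)
      · rw [hx]
        exact subset_adjoin M _ (Set.mem_union_right _ (Set.mem_singleton _))
      · rw [Set.mem_singleton_iff.1 hx]
        have h1 : (y₀ + y₁) - y₀ ∈ adjoin M (({y₀ + y₁, y₀ * y₁} : Set ℂ) ∪ {y₀}) :=
          sub_mem (subset_adjoin M _ (Set.mem_union_left _ (Set.mem_insert _ _))) (subset_adjoin M _ (Set.mem_union_right _ (Set.mem_singleton _)))
        rwa [add_sub_cancel_left] at h1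
  -- `[M(y₀, y₁) : M]` two ways: `2 t = 5 d`, `1 ≤ d ≤ 4`
  have hdeg1 : Module.finrank M ↥M⟮y₀, y₁⟯ = Module.finrank M F * 2 := by
    have h1 : Module.finrank M ↥M⟮y₀, y₁⟯ = Module.finrank M ↥((F⟮y₀⟯).restrictScalars M) := by rw [hFy]
    rw [h1, show Module.finrank M ↥((F⟮y₀⟯).restrictScalars M) = Module.finrank M ↥(F⟮y₀⟯) from rfl,
      ← Module.finrank_mul_finrank M ↥F ↥(F⟮y₀⟯), adjoin.finrank (hy₀M.tower_top : IsIntegral F y₀), hdegF]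
  have hdeg2 : Module.finrank M ↥M⟮y₀, y₁⟯ = 5 * (minpoly M⟮y₀⟯ y₁).natDegree := by
    rw [finrank_adjoin_pair_eq_mul y₀ hy₁M, adjoin.finrank hy₀M, hminy₀, h5b]
  have hdle : (minpoly M⟮y₀⟯ y₁).natDegree ≤ 4 := natDegree_minpoly_adjoin_conj_le_four hb h5b hy₀ hy₁
  have hdpos : 0 < (minpoly M⟮y₀⟯ y₁).natDegree := minpoly.natDegree_pos hy₁M.tower_top
  have ht5 : Module.finrank M F = 5 := by
    obtain ⟨j, -, hj⟩ := (Nat.dvd_prime_pow Nat.prime_five).1 ht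
    have heq : Module.finrank M F * 2 = 5 * (minpoly M⟮y₀⟯ y₁).natDegree := hdeg1.symm.trans hdeg2
    rw [hj] at heq ⊢
    rcases j with _ | _ | j
    · rw [pow_zero] at heq
      omega
    · rw [pow_one]
    · exfalso
      have h25 : 25 ≤ 5 ^ (j + 2) :=
        calc (25 : ℕ) = 5 ^ 2 := by norm_num
          _ ≤ 5 ^ (j + 2) := Nat.pow_le_pow_right (by norm_num) (by omega)
      omega
  haveI : FiniteDimensional M F := Module.finite_of_finrank_pos (by rw [ht5]; norm_num)
  -- `F = M(a)` for a generator `a ∈ {u, v}` outside `M` (`[F : M] = 5` is prime)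
  have hgen : ∃ a ∈ ({y₀ + y₁, y₀ * y₁} : Set ℂ), a ∉ (⊥ : IntermediateField M ℂ) := by
    by_contra hall
    push Not at hall
    have hFbot : F ≤ ⊥ := by rw [hFdef]; exact adjoin_le_iff.2 fun x hx => hall x hx
    have hd := finrank_dvd_of_le_right hFbot
    rw [IntermediateField.finrank_bot, ht5] at hd
    exact absurd (Nat.dvd_one.1 hd) (by norm_num)
  obtain ⟨a, haS, haM⟩ := hgen
  have haFmem : a ∈ F := by rw [hFdef]; exact subset_adjoin M _ haS
  have haF : M⟮a⟯ = F := by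
    have hle : M⟮a⟯ ≤ F := adjoin_le_iff.2 (Set.singleton_subset_iff.2 haFmem)
    refine eq_of_le_of_finrank_eq hle ?_
    have hd : Module.finrank M M⟮a⟯ ∣ 5 := by rw [← ht5]; exact finrank_dvd_of_le_right hle
    have hne1 : Module.finrank M M⟮a⟯ ≠ 1 := fun h => haM (finrank_adjoin_simple_eq_one_iff.1 h)
    rw [ht5]
    rcases (Nat.dvd_prime Nat.prime_five).1 hd with h | h
    · exact absurd h hne1
    · exact h
  -- the quintic degree chase for `(a, y₀)` gives `[M(a, y₀) : M] = 25` …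
  have haint : IsIntegral M a := isIntegral_iff.1 (IsIntegral.of_finite M (⟨a, hFE haFmem⟩ : E))
  have h5a : (minpoly M a).natDegree = 5 := by rw [← adjoin.finrank haint, haF, ht5]
  have h5y₀ : (minpoly M y₀).natDegree = 5 := by rw [hminy₀, h5b]
  have H : ∀ x y : ℂ, aeval x (minpoly M a) = 0 → aeval y (minpoly M y₀) = 0 → y ∉ M⟮x⟯ := by
    intro x y hx hy hyx
    obtain ⟨y', hy'g, hy'a⟩ := exists_root_mem_adjoin_of_root_mem_adjoin_conj haint hx hy hyx
    rw [hminy₀] at hy'g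
    rw [haF] at hy'a
    exact hNR y' hy'g (hFE hy'a)
  have h25 := finrank_adjoin_pair_eq_of_forall_not_mem haint hy₀M h5a h5y₀ H
  -- … but `y₀` has degree `≤ 2` over `M(a) = F ∋ u, v`
  have hle2 : (minpoly M⟮a⟯ y₀).natDegree ≤ 2 :=
    natDegree_minpoly_le_two_of_add_mem_of_mul_mem M⟮a⟯ (by rw [haF]; exact huF) (by rw [haF]; exact hvF)
  rw [finrank_adjoin_pair_eq_mul a hy₀M, adjoin.finrank haint, h5a] at h25
  omega

/-- **THE QUINTIC STEP, ABSTRACT FORM.**  `[E : M] = 5^m`, `b` of degree `5` over `M` with NO conjugate in `E` ⟹ `b` has degree `5` over `E`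
(`exists_quadratic_class_of_natDegree_ne_five` + `false_of_quadratic_class`). [cite: Lang2002, V §1 Prop. 1.2, VI §1 Thm. 1.1] -/
theorem natDegree_minpoly_eq_five_of_forall_root_not_mem (E : IntermediateField M ℂ) {m : ℕ} (hfinE : Module.finrank M E = 5 ^ m) {b : ℂ}
    (hb : IsIntegral M b) (h5b : (minpoly M b).natDegree = 5) (hNR : ∀ y : ℂ, aeval y (minpoly M b) = 0 → y ∉ E) :
    (minpoly E b).natDegree = 5 := by
  by_contra h5
  obtain ⟨y₀, y₁, hy₀, hy₁, hne, hmin, hd₀⟩ := exists_quadratic_class_of_natDegree_ne_five E hb h5b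
    (fun y hy h => hNR y hy (mem_of_natDegree_minpoly_eq_one E h)) h5
  exact false_of_quadratic_class E hfinE hb h5b hNR hy₀ hy₁ hne hmin hd₀

end Chase

end Summit.HodgeConjecture.CorCM.MultiFieldWeil

end
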